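import Summits.QuantumFields.BalabanUV.Beta.FP.GhostLoopCountingMix
import Summits.QuantumFields.BalabanUV.Beta.FP.FineSplitJunctionMajorant

/-!
# `Beta/FP/GhostMixQuarticTwoLeg` — road «FP» (binder row D1), row KER-γ (α2) sub-row **α2-c** «GHOST», THE (MIX-4) GHOST WORD IN THE JUNCTION's TWO-LEG
# MAJORANT CURRENCY (ruling R-FP-36 (b) «the quartic twin's shape»: per `(c, e)` entry the POINTWISE majorant `κ(b,b′)` + its windowed majorant letter (Mκ) of
# `FineSplitJunctionMajorant.coarse_secondMoment_abs_of_majorant_twoLeg` ∕ `rem_of_majorant` (F′) — the (MIX-4) pair mass does NOT factor into `M₁ b·M₂ b′`)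

HONEST DEPENDENCY (page 1, mandatory): continuum YM on T⁴ ⇐ BetaPertH ∧ nine spine estimates (0/9 proved); BetaPertH ⇐ (D1) ∧ (D4) ∧
CAP+tail; G-an2-4 gates asym, D1 and NE2/3/4.  HONEST FRAMING (cell contract, verbatim): «discharging `BetaPertH` makes Bałaban's UV
stability UNCONDITIONAL — a real constructive-QFT result; it is NOT the continuum limit and NOT the Clay problem.»  THIS MODULE is [folklore] lattice
bookkeeping on `ℤ⁴` BY NAME over `MixLoopPowerCountingMassQuartic.abs_mix4_le_mass` (the quartic pointwise shape, sup letter of the inner leg only),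
`AveragingJetLettersRootedSecond` (`ker₂`, `exists_of_ker₂_ne_zero`, `sum_ker₂_outer_le` — GENERIC in the letter type, here BOND letters `Pt × Fin 4`),
`ScalarAveragingJetLetters.scl_windowedMass_le_half` (position `Prod.fst`), `GhostLoopCountingMix.ghostColumn_engineLetters` (the (I-gh) sup letter of `kerH (N−1) a`)
and F′.  It is my own `GhostLoopCountingMixQuartic.windowedPairMass_scl_le` (p248411, letter type `Pt`) re-done with bond letters — the `(c, e)` entry of the quartic
ghost word puts BOTH background letters, the `c`-bond at `b` and the `e`-bond at `b′`, on ONE averaging path.  It asserts nothing about Bałaban's constrained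
objects, cites nothing, mints no `Prop` fact, has no `def`, 0 sorry.  NOT α2-c PART 2, NOT (LEDGER-gh)'s numbers, NOT hsplit, NOT D1, NOT BetaPertH, NOT continuum,
NOT Clay.

ABSOLUTE RULE (cell charter, verbatim): «No internally-minted statement may enter as a cited fact. Every hypothesis is either kernel-proved in this
package or a verbatim quotation of a PUBLISHED theorem with page reference. The manuscript(s) under audit are NOT citable for their own disputed
steps — they are the thing under adjudication; programme-internal (2001/route/tribunal) claims are never citable.»

CONTENT ([folklore]∕[our object]): §1 **`pairWeight_bond_le_of_ker₂_ne_zero`**, **`windowedPairMass_bond_le`** (the (Mκ) letter of the bond-letter pair mass, every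
coarse centre `v₀`, all windows); §2 **`ghost_mix4_twoLeg`** ((κ) ∧ (Mκ) of the ghost (MIX-4) word's `(c,e)` entry with inner leg `kerH (N−1) a`, every `δ > 0`);
§3 **`ghost_mix4_secondMoment_twoLeg`** (F′'s `coarse_secondMoment_abs_of_majorant_twoLeg` BY NAME at the pair, ANY two outer legs with (J)(J′)).
Provenance: D1 formalisation swarm LEAF PROVER 05, unit `b2b-balaban-beta-d1-formalise-leaf-05` gen 15, 2026-08-21, road FP row KER-γ (α2) sub-row α2-c (owner GO
R-FP-35 (a), words l.28227; R-FP-36 (b)); «not in print; our bookkeeping»; no existing file touched.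
-/

noncomputable section

namespace Summit.QuantumFields.BalabanUV.Beta.FP.GhostMixQuarticTwoLeg

open Finset Real
open scoped BigOperators
open Literature.MathematicalPhysics.QuantumFieldTheory.Balaban1983to89
open Literature.MathematicalPhysics.QuantumFieldTheory.Balaban1983to89.Beta
open DyadicShell (Pt supNorm)
open BlockLegs (supNorm_sub_le_real)
open AxialBlockWeights (fineBlock)
open B5Hk103ScalarZd (kerH deltaH deltaH_pos)
open Summit.QuantumFields.BalabanUV.Beta.FP.AveragingJetLettersRooted (mass₁ mass₁_nonneg)
open Summit.QuantumFields.BalabanUV.Beta.FP.AveragingJetLettersRootedSecond (ker₂ ker₂_nonneg exists_of_ker₂_ne_zero sum_ker₂_outer_le)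
open Summit.QuantumFields.BalabanUV.Beta.FP.ScalarAveragingJetLetters
open Summit.QuantumFields.BalabanUV.Beta.FP.MixLoopPowerCountingMassQuartic (abs_mix4_le_mass)
open Summit.QuantumFields.BalabanUV.Beta.FP.GhostLoopCountingMix (ghostColumn_engineLetters)
open Summit.QuantumFields.BalabanUV.Beta.FP.FineSplitJunctionMajorant (coarse_secondMoment_abs_of_majorant_twoLeg)

/-! ## §1 The pair weight off one bond word and the (Mκ) letter of the bond-letter pair mass -/

section Bond

variable {σ : Type*} [Fintype σ] {N : ℕ} {p : σ → ℝ} {rad : σ → Pt → Pt → List (Pt × Fin 4)} {ℓ₀ R₀ : ℕ}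

/-- [folklore] **THE PAIR WEIGHT READ OFF ONE BOND WORD**: a nonzero `ker₂^{(u)} (b,c) (b′,e) x` puts BOTH bond letters on one averaging path of block `u`, hence both
positions within `R₀·N` of `N•u`, so `1 + (‖b′−b‖∞∕N)² ≤ 1 + 4R₀²` (`N ≥ 1`). -/
theorem pairWeight_bond_le_of_ker₂_ne_zero (hN : 1 ≤ N)
    (hradR : ∀ (s : σ) (u : Pt) (x : ↥(fineBlock N)) (ℓ : Pt × Fin 4), ℓ ∈ rad s u x.1 → supNorm (ℓ.1 - (N : ℤ) • u) ≤ R₀ * N)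
    {u b b' x : Pt} {c e : Fin 4} (h : ker₂ (sclW N p) (sclFld N u) (sclBg N u rad) (b, c) (b', e) x ≠ 0) :
    1 + ((supNorm (b' - b) : ℝ) / N) ^ 2 ≤ 1 + 4 * (R₀ : ℝ) ^ 2 := by
  obtain ⟨ev, _, hb, hb'⟩ := exists_of_ker₂_ne_zero h
  have h1 : supNorm (b - (N : ℤ) • u) ≤ R₀ * N := hradR ev.2 u ev.1 (b, c) hb
  have h2 : supNorm (b' - (N : ℤ) • u) ≤ R₀ * N := hradR ev.2 u ev.1 (b', e) hb'
  have hN' : (0 : ℝ) < N := by exact_mod_cast hN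
  have e1 : b' - b = (b' - (N : ℤ) • u) - (b - (N : ℤ) • u) := by abel
  have hreal : (supNorm (b' - b) : ℝ) ≤ supNorm (b' - (N : ℤ) • u) + supNorm (b - (N : ℤ) • u) := by
    rw [e1]; exact supNorm_sub_le_real _ _
  have h1' : (supNorm (b - (N : ℤ) • u) : ℝ) ≤ (R₀ : ℝ) * N := by exact_mod_cast h1
  have h2' : (supNorm (b' - (N : ℤ) • u) : ℝ) ≤ (R₀ : ℝ) * N := by exact_mod_cast h2
  have hq : (supNorm (b' - b) : ℝ) / N ≤ 2 * R₀ := by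
    rw [div_le_iff₀ hN']; linarith
  have hq0 : 0 ≤ (supNorm (b' - b) : ℝ) / N := by positivity
  nlinarith

/-- **(Mκ) FOR THE BOND-LETTER PAIR MASS `m_{c,e}(b,b′) = Σ_{u∈U b}Σ_{w∈W}|ker₂^{(u)} (b,c) (b′,e) (b+w)|` OF THE 0-FORM FAMILY, with the pair's own separation weight**
([folklore]; ANY coarse windows `U b`, ANY finite `W`, `S`, every coarse centre `v₀`, every `(c, e)`):
`Σ_{b∈S}Σ_{b′∈S} e^{−(δ∕(2N))‖b−N•v₀‖∞}·(1+(‖b′−b‖∞∕N)²)·m_{c,e}(b,b′) ≤ (1+4R₀²)·(2ℓ₀·(ℓ₀·Σp))·e^{δR₀∕2}·(e^{δ∕2}(1+480e^{δ∕4}(4∕δ)⁴))`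
(pair weight by `pairWeight_bond_le_of_ker₂_ne_zero`; the inner bond letters `(b′, e)`, `b′ ∈ S`, are a sub-window of all bond letters, `sum_ker₂_outer_le`
(`Σ_{ℓ′}Σ_x ker₂ (b,c) ℓ′ x ≤ 2ℓ₀·mass₁ (b,c)`); then `scl_windowedMass_le_half` BY NAME at letter type `Pt × Fin 4`, position `Prod.fst`, bond window `S × {c}`). -/
theorem windowedPairMass_bond_le {δ : ℝ} (hδ : 0 < δ) (hN : 1 ≤ N) (hp : ∀ s, 0 ≤ p s)
    (hrad : ∀ s u x', (rad s u x').length ≤ ℓ₀)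
    (hradR : ∀ (s : σ) (u : Pt) (x : ↥(fineBlock N)) (ℓ : Pt × Fin 4), ℓ ∈ rad s u x.1 → supNorm (ℓ.1 - (N : ℤ) • u) ≤ R₀ * N)
    (U : Pt → Finset Pt) (W S : Finset Pt) (v₀ : Pt) (c e : Fin 4) :
    ∑ b ∈ S, ∑ b' ∈ S, Real.exp (-(δ / (2 * N)) * (supNorm (b - (N : ℤ) • v₀) : ℝ)) *
        (1 + ((supNorm (b' - b) : ℝ) / N) ^ 2) *
          (∑ u ∈ U b, ∑ w ∈ W, |ker₂ (sclW N p) (sclFld N u) (sclBg N u rad) (b, c) (b', e) (b + w)|)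
      ≤ (1 + 4 * (R₀ : ℝ) ^ 2) * (((2 * ((ℓ₀ : ℕ) : ℝ)) * (((ℓ₀ : ℕ) : ℝ) * ∑ s, p s)) * Real.exp (δ * R₀ / 2) *
          (Real.exp (δ / 2) * (1 + 480 * Real.exp (δ / 4) * (4 / δ) ^ 4))) := by
  classical
  set Y : Finset Pt := S.biUnion U with hY
  have hω := sclW_nonneg N hp
  set K : Pt → Pt → Pt → ℝ := fun u b b' => ∑ w ∈ W, ker₂ (sclW N p) (sclFld N u) (sclBg N u rad) (b, c) (b', e) (b + w) with hK
  have hK0 : ∀ u b b', 0 ≤ K u b b' := fun u b b' => Finset.sum_nonneg fun w _ => ker₂_nonneg hω _ _ _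
  -- (i) pointwise: the pair weight against the nonnegative kernel
  have hpt : ∀ u b b', (1 + ((supNorm (b' - b) : ℝ) / N) ^ 2) *
      (∑ w ∈ W, |ker₂ (sclW N p) (sclFld N u) (sclBg N u rad) (b, c) (b', e) (b + w)|) ≤ (1 + 4 * (R₀ : ℝ) ^ 2) * K u b b' := by
    intro u b b'
    rw [hK, Finset.mul_sum, Finset.mul_sum]
    refine Finset.sum_le_sum fun w _ => ?_
    rw [abs_of_nonneg (ker₂_nonneg hω _ _ _)]
    by_cases hz : ker₂ (sclW N p) (sclFld N u) (sclBg N u rad) (b, c) (b', e) (b + w) = 0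
    · rw [hz, mul_zero, mul_zero]
    · exact mul_le_mul_of_nonneg_right (pairWeight_bond_le_of_ker₂_ne_zero hN hradR hz) (ker₂_nonneg hω _ _ _)
  -- (ii) per insertion `b`: the weighted pair mass over `b′ ∈ S` is at most `(1+4R₀²)·2ℓ₀·Σ_{u∈Y} mass₁^{(u)} (b,c)`
  have hrow : ∀ b ∈ S, ∑ b' ∈ S, (1 + ((supNorm (b' - b) : ℝ) / N) ^ 2) *
      (∑ u ∈ U b, ∑ w ∈ W, |ker₂ (sclW N p) (sclFld N u) (sclBg N u rad) (b, c) (b', e) (b + w)|)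
      ≤ (1 + 4 * (R₀ : ℝ) ^ 2) * ((2 * ((ℓ₀ : ℕ) : ℝ)) * ∑ u ∈ Y, mass₁ (sclW N p) (sclBg N u rad) (b, c)) := by
    intro b hb
    have hUb : U b ⊆ Y := by rw [hY]; exact Finset.subset_biUnion_of_mem U hb
    have hstep1 : ∑ b' ∈ S, (1 + ((supNorm (b' - b) : ℝ) / N) ^ 2) *
        (∑ u ∈ U b, ∑ w ∈ W, |ker₂ (sclW N p) (sclFld N u) (sclBg N u rad) (b, c) (b', e) (b + w)|)
        ≤ ∑ b' ∈ S, ∑ u ∈ U b, (1 + 4 * (R₀ : ℝ) ^ 2) * K u b b' := by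
      refine Finset.sum_le_sum fun b' _ => ?_
      rw [Finset.mul_sum]
      exact Finset.sum_le_sum fun u _ => hpt u b b'
    have hstep2 : ∑ b' ∈ S, ∑ u ∈ U b, (1 + 4 * (R₀ : ℝ) ^ 2) * K u b b'
        = (1 + 4 * (R₀ : ℝ) ^ 2) * ∑ u ∈ U b, ∑ b' ∈ S, K u b b' := by
      rw [Finset.sum_comm, Finset.mul_sum]
      refine Finset.sum_congr rfl fun u _ => ?_
      rw [Finset.mul_sum]
    have hstep3 : ∀ u, ∑ b' ∈ S, K u b b' ≤ (2 * ((ℓ₀ : ℕ) : ℝ)) * mass₁ (sclW N p) (sclBg N u rad) (b, c) := by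
      intro u
      -- the inner bond letters `(b′, e)`, `b′ ∈ S`
      have h := sum_ker₂_outer_le hω (length_sclBg_le u (hrad · u ·)) (b, c)
        (S.map ⟨fun b' => (b', e), fun x y h => congrArg Prod.fst h⟩) (W.image fun w => b + w) (fld := sclFld N u)
      rw [Finset.sum_map] at h
      have e : ∀ b', K u b b' = ∑ x ∈ W.image (fun w => b + w), ker₂ (sclW N p) (sclFld N u) (sclBg N u rad) (b, c) (b', e) x := by
        intro b'
        rw [hK, Finset.sum_image (fun x _ y _ h => add_left_cancel h)]
      simp only [e]
      exact h
    have hstep4 : ∑ u ∈ U b, ∑ b' ∈ S, K u b b' ≤ (2 * ((ℓ₀ : ℕ) : ℝ)) * ∑ u ∈ Y, mass₁ (sclW N p) (sclBg N u rad) (b, c) := by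
      calc ∑ u ∈ U b, ∑ b' ∈ S, K u b b' ≤ ∑ u ∈ U b, (2 * ((ℓ₀ : ℕ) : ℝ)) * mass₁ (sclW N p) (sclBg N u rad) (b, c) :=
            Finset.sum_le_sum fun u _ => hstep3 u
        _ ≤ ∑ u ∈ Y, (2 * ((ℓ₀ : ℕ) : ℝ)) * mass₁ (sclW N p) (sclBg N u rad) (b, c) :=
            Finset.sum_le_sum_of_subset_of_nonneg hUb fun u _ _ => mul_nonneg (by positivity) (mass₁_nonneg hω (b, c))
        _ = (2 * ((ℓ₀ : ℕ) : ℝ)) * ∑ u ∈ Y, mass₁ (sclW N p) (sclBg N u rad) (b, c) := by rw [Finset.mul_sum]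
    calc _ ≤ _ := hstep1
      _ = _ := hstep2
      _ ≤ _ := mul_le_mul_of_nonneg_left hstep4 (by positivity)
  -- (iii) the window against the first-jet mass function of the bond letters `(b, c)`: `scl_windowedMass_le_half` at the centre `N•v₀`
  have hradR' : ∀ (s : σ) (u : Pt) (x : ↥(fineBlock N)) (ℓ : Pt × Fin 4), ℓ ∈ rad s u x.1 →
      (supNorm (Prod.fst ℓ - (N : ℤ) • u) : ℝ) ≤ (R₀ : ℝ) * N := by
    intro s u x ℓ h
    exact_mod_cast hradR s u x ℓ h
  have hM := scl_windowedMass_le_half (B := Pt × Fin 4) hδ hN hp hrad Prod.fst hradR'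
    (S.map ⟨fun b => (b, c), fun x y h => congrArg Prod.fst h⟩) Y ((N : ℤ) • v₀)
  rw [Finset.sum_map] at hM
  have hM' : ∑ b ∈ S, Real.exp (-(δ / (2 * N)) * (supNorm (b - (N : ℤ) • v₀) : ℝ)) * ∑ u ∈ Y, mass₁ (sclW N p) (sclBg N u rad) (b, c)
      ≤ (((ℓ₀ : ℕ) : ℝ) * ∑ s, p s) * Real.exp (δ * R₀ / 2) * (Real.exp (δ / 2) * (1 + 480 * Real.exp (δ / 4) * (4 / δ) ^ 4)) := by
    simpa using hM
  calc ∑ b ∈ S, ∑ b' ∈ S, Real.exp (-(δ / (2 * N)) * (supNorm (b - (N : ℤ) • v₀) : ℝ)) *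
          (1 + ((supNorm (b' - b) : ℝ) / N) ^ 2) *
            (∑ u ∈ U b, ∑ w ∈ W, |ker₂ (sclW N p) (sclFld N u) (sclBg N u rad) (b, c) (b', e) (b + w)|)
      = ∑ b ∈ S, Real.exp (-(δ / (2 * N)) * (supNorm (b - (N : ℤ) • v₀) : ℝ)) *
          ∑ b' ∈ S, (1 + ((supNorm (b' - b) : ℝ) / N) ^ 2) *
            (∑ u ∈ U b, ∑ w ∈ W, |ker₂ (sclW N p) (sclFld N u) (sclBg N u rad) (b, c) (b', e) (b + w)|) := by
        refine Finset.sum_congr rfl fun b _ => ?_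
        rw [Finset.mul_sum]
        exact Finset.sum_congr rfl fun b' _ => by ring
    _ ≤ ∑ b ∈ S, Real.exp (-(δ / (2 * N)) * (supNorm (b - (N : ℤ) • v₀) : ℝ)) *
          ((1 + 4 * (R₀ : ℝ) ^ 2) * ((2 * ((ℓ₀ : ℕ) : ℝ)) * ∑ u ∈ Y, mass₁ (sclW N p) (sclBg N u rad) (b, c))) :=
        Finset.sum_le_sum fun b hb => mul_le_mul_of_nonneg_left (hrow b hb) (Real.exp_pos _).le
    _ = (1 + 4 * (R₀ : ℝ) ^ 2) * (2 * ((ℓ₀ : ℕ) : ℝ)) *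
          ∑ b ∈ S, Real.exp (-(δ / (2 * N)) * (supNorm (b - (N : ℤ) • v₀) : ℝ)) * ∑ u ∈ Y, mass₁ (sclW N p) (sclBg N u rad) (b, c) := by
        rw [Finset.mul_sum]
        exact Finset.sum_congr rfl fun b _ => by ring
    _ ≤ (1 + 4 * (R₀ : ℝ) ^ 2) * (2 * ((ℓ₀ : ℕ) : ℝ)) *
          ((((ℓ₀ : ℕ) : ℝ) * ∑ s, p s) * Real.exp (δ * R₀ / 2) * (Real.exp (δ / 2) * (1 + 480 * Real.exp (δ / 4) * (4 / δ) ^ 4))) :=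
        mul_le_mul_of_nonneg_left hM' (by positivity)
    _ = _ := by ring

end Bond

/-! ## §2 The ghost (MIX-4) word: the (κ) ∧ (Mκ) pair -/

section Ghost

/-- **`ghost_mix4_twoLeg` — THE GHOST (MIX-4) WORD IN THE TWO-LEG MAJORANT CURRENCY** ([our object]).  With the (I-gh) sup constant `Cg` of
`ghostColumn_engineLetters`: for EVERY `δ > 0` (the window rate is free — the word is supported on one path), `a > 0`, `N ≥ 1`, every 0-form rooted block family with
BOND letters (`p ≥ 0`, word length `≤ ℓ₀`, letters within `R₀N` of the root block), ANY coarse windows `U b` and finite offsets `W`:  (κ) for every `(c, e)`, `b`, `b′`, the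
`(c, e)` entry of the word — ONE second-order jet carrying the `c`-bond at `b` and the `e`-bond at `b′`, inner leg the scalar minimiser `kerH (N−1) a` —
`|Σ_{u∈U b}Σ_{w∈W} ker₂^{(u)} (b,c) (b′,e) (b+w)·kerH(b+w,u)| ≤ Cg·m_{c,e}(b,b′)`;  (Mκ) for every `(c, e)`, coarse centre `v₀` and fine window `S`,
`Σ_{b,b′∈S} e^{−(δ∕(2N))‖b−N•v₀‖∞}·(1+(‖b′−b‖∞∕N)²)·(Cg·m_{c,e}(b,b′)) ≤ Cg·(1+4R₀²)·(2ℓ₀·(ℓ₀·Σp))·e^{δR₀∕2}·(e^{δ∕2}(1+480e^{δ∕4}(4∕δ)⁴))`.  These are the (hk)(Mκ)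
binders of `FineSplitJunctionMajorant.coarse_secondMoment_abs_of_majorant_twoLeg` ∕ `rem_window_of_majorant` (`κ c e := Cg·m_{c,e}`, anchor `v₀ = 0` there);
every power of `N` displayed (none). -/
theorem ghost_mix4_twoLeg :
    ∃ Cg : ℝ, 0 ≤ Cg ∧ ∀ δ : ℝ, 0 < δ → ∀ {a : ℝ}, 0 < a → ∀ (N : ℕ), 1 ≤ N →
      ∀ {σ : Type*} [Fintype σ] {p : σ → ℝ} (_ : ∀ s, 0 ≤ p s)
        {rad : σ → Pt → Pt → List (Pt × Fin 4)} {ℓ₀ R₀ : ℕ} (_ : ∀ s u x', (rad s u x').length ≤ ℓ₀)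
        (_ : ∀ (s : σ) (u : Pt) (x : ↥(fineBlock N)) (ℓ : Pt × Fin 4), ℓ ∈ rad s u x.1 → supNorm (ℓ.1 - (N : ℤ) • u) ≤ R₀ * N)
        (U : Pt → Finset Pt) (W : Finset Pt),
        (∀ (c e : Fin 4) (b b' : Pt),
          |∑ u ∈ U b, ∑ w ∈ W, ker₂ (sclW N p) (sclFld N u) (sclBg N u rad) (b, c) (b', e) (b + w) * kerH (N - 1) a (b + w) u|
            ≤ Cg * ∑ u ∈ U b, ∑ w ∈ W, |ker₂ (sclW N p) (sclFld N u) (sclBg N u rad) (b, c) (b', e) (b + w)|) ∧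
        (∀ (c e : Fin 4) (v₀ : Pt) (S : Finset Pt),
          ∑ b ∈ S, ∑ b' ∈ S, Real.exp (-(δ / (2 * N)) * (supNorm (b - (N : ℤ) • v₀) : ℝ)) *
              (1 + ((supNorm (b' - b) : ℝ) / N) ^ 2) *
                (Cg * ∑ u ∈ U b, ∑ w ∈ W, |ker₂ (sclW N p) (sclFld N u) (sclBg N u rad) (b, c) (b', e) (b + w)|)
            ≤ Cg * ((1 + 4 * (R₀ : ℝ) ^ 2) * (((2 * ((ℓ₀ : ℕ) : ℝ)) * (((ℓ₀ : ℕ) : ℝ) * ∑ s, p s)) * Real.exp (δ * R₀ / 2) *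
                (Real.exp (δ / 2) * (1 + 480 * Real.exp (δ / 4) * (4 / δ) ^ 4))))) := by
  obtain ⟨C, C', hC, _, h⟩ := ghostColumn_engineLetters
  refine ⟨C, hC, fun δ hδ a ha N hN σ _ p hp rad ℓ₀ R₀ hrad hradR U W => ⟨?_, ?_⟩⟩
  · intro c e b b'
    obtain ⟨hI, _⟩ := h ha N hN
    -- the sup letter of the inner leg
    have hI0 : ∀ x u : Pt, |kerH (N - 1) a x u| ≤ C := by
      intro x u
      refine (hI x u).trans ?_
      have h1 : Real.exp (-(deltaH 4 1 / N) * (supNorm (x - (N : ℤ) • u) : ℝ)) ≤ 1 := by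
        apply Real.exp_le_one_iff.mpr
        have hδH : 0 < deltaH 4 1 := deltaH_pos 4 one_pos
        have hN' : (0 : ℝ) < N := by exact_mod_cast hN
        have : (0 : ℝ) ≤ (supNorm (x - (N : ℤ) • u) : ℝ) := Nat.cast_nonneg _
        have : 0 ≤ deltaH 4 1 / N * (supNorm (x - (N : ℤ) • u) : ℝ) := by positivity
        linarith
      calc C * Real.exp (-(deltaH 4 1 / N) * (supNorm (x - (N : ℤ) • u) : ℝ)) ≤ C * 1 := mul_le_mul_of_nonneg_left h1 hC
        _ = C := mul_one C
    exact abs_mix4_le_mass (U := U) (W := W)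
      (qdd := fun u b b' x => ker₂ (sclW N p) (sclFld N u) (sclBg N u rad) (b, c) (b', e) x)
      (I := fun x u => kerH (N - 1) a x u) hI0 b b'
  · intro c e v₀ S
    have hW := windowedPairMass_bond_le hδ hN hp hrad hradR U W S v₀ c e
    calc ∑ b ∈ S, ∑ b' ∈ S, Real.exp (-(δ / (2 * N)) * (supNorm (b - (N : ℤ) • v₀) : ℝ)) *
            (1 + ((supNorm (b' - b) : ℝ) / N) ^ 2) *
              (C * ∑ u ∈ U b, ∑ w ∈ W, |ker₂ (sclW N p) (sclFld N u) (sclBg N u rad) (b, c) (b', e) (b + w)|)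
        = C * ∑ b ∈ S, ∑ b' ∈ S, Real.exp (-(δ / (2 * N)) * (supNorm (b - (N : ℤ) • v₀) : ℝ)) *
            (1 + ((supNorm (b' - b) : ℝ) / N) ^ 2) *
              (∑ u ∈ U b, ∑ w ∈ W, |ker₂ (sclW N p) (sclFld N u) (sclBg N u rad) (b, c) (b', e) (b + w)|) := by
          rw [Finset.mul_sum]
          refine Finset.sum_congr rfl fun b _ => ?_
          rw [Finset.mul_sum]
          exact Finset.sum_congr rfl fun b' _ => by ring
      _ ≤ _ := mul_le_mul_of_nonneg_left hW hC

/-! ## §3 The by-name junction check: the pair IS the input of F′'s two-leg majorant core, for ANY two outer legs -/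

/-- **`ghost_mix4_secondMoment_twoLeg` — THE GHOST (MIX-4) WORD THROUGH F′'s TWO-LEG MAJORANT CORE** ([our object];
`FineSplitJunctionMajorant.coarse_secondMoment_abs_of_majorant_twoLeg` BY NAME at §2's pair): with `Cg` of `ghost_mix4_twoLeg`, for every `δ > 0`, `a > 0`, `N ≥ 1`,
family and windows as there, every `(c, e)`, ANY reference leg `J₁` with (J) at rate `δ∕N` and anchor `v₀` and running leg `J₂` with (J′), all finite `S`, `V`:
`Σ_{v∈V}‖v−v₀‖∞²·Σ_{b,b′∈S}|J₁ b|·|J₂ b′ v|·|k₄^{gh,(c,e)}(b,b′)| ≤ 3·C_J·C_J′·(1+16∕δ²)·(Cg·(1+4R₀²)·(2ℓ₀·(ℓ₀·Σp))·e^{δR₀∕2}·(e^{δ∕2}(1+480e^{δ∕4}(4∕δ)⁴)))`. -/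
theorem ghost_mix4_secondMoment_twoLeg :
    ∃ Cg : ℝ, 0 ≤ Cg ∧ ∀ δ : ℝ, 0 < δ → ∀ {a : ℝ}, 0 < a → ∀ (N : ℕ), 1 ≤ N →
      ∀ {σ : Type*} [Fintype σ] {p : σ → ℝ} (_ : ∀ s, 0 ≤ p s)
        {rad : σ → Pt → Pt → List (Pt × Fin 4)} {ℓ₀ R₀ : ℕ} (_ : ∀ s u x', (rad s u x').length ≤ ℓ₀)
        (_ : ∀ (s : σ) (u : Pt) (x : ↥(fineBlock N)) (ℓ : Pt × Fin 4), ℓ ∈ rad s u x.1 → supNorm (ℓ.1 - (N : ℤ) • u) ≤ R₀ * N)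
        (U : Pt → Finset Pt) (W : Finset Pt) (c e : Fin 4)
        {J₁ : Pt → ℝ} {J₂ : Pt → Pt → ℝ} {C_J C_J' : ℝ} (S V : Finset Pt) (v₀ : Pt)
        (_ : ∀ b, |J₁ b| ≤ C_J * Real.exp (-(δ / N) * (supNorm (b - (N : ℤ) • v₀) : ℝ)))
        (_ : ∀ b', ∑ v ∈ V, (1 + ((supNorm (b' - (N : ℤ) • v) : ℝ) / N) ^ 2) * |J₂ b' v| ≤ C_J'),
        ∑ v ∈ V, (supNorm (v - v₀) : ℝ) ^ 2 * ∑ b ∈ S, ∑ b' ∈ S, |J₁ b| * |J₂ b' v| *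
            |∑ u ∈ U b, ∑ w ∈ W, ker₂ (sclW N p) (sclFld N u) (sclBg N u rad) (b, c) (b', e) (b + w) * kerH (N - 1) a (b + w) u|
          ≤ 3 * C_J * C_J' * (1 + 16 / δ ^ 2) *
              (Cg * ((1 + 4 * (R₀ : ℝ) ^ 2) * (((2 * ((ℓ₀ : ℕ) : ℝ)) * (((ℓ₀ : ℕ) : ℝ) * ∑ s, p s)) * Real.exp (δ * R₀ / 2) *
                (Real.exp (δ / 2) * (1 + 480 * Real.exp (δ / 4) * (4 / δ) ^ 4))))) := by
  obtain ⟨Cg, hCg, h⟩ := ghost_mix4_twoLeg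
  refine ⟨Cg, hCg, fun δ hδ a ha N hN σ _ p hp rad ℓ₀ R₀ hrad hradR U W c e J₁ J₂ C_J C_J' S V v₀ hJ hJ' => ?_⟩
  obtain ⟨hk, hM⟩ := h δ hδ ha N hN hp hrad hradR U W
  exact coarse_secondMoment_abs_of_majorant_twoLeg (n := N) (S := S) (V := V) (v₀ := v₀) (J₁ := J₁) (J₂ := J₂)
    (κ := fun b b' => Cg * ∑ u ∈ U b, ∑ w ∈ W, |ker₂ (sclW N p) (sclFld N u) (sclBg N u rad) (b, c) (b', e) (b + w)|)
    hδ hN (fun b b' => hk c e b b') hJ hJ' (hM c e v₀ S)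

end Ghost

end Summit.QuantumFields.BalabanUV.Beta.FP.GhostMixQuarticTwoLeg

end
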